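/-
Origin: expansion seat `planner-pub-hodgecm-prl2-g3-0`, handover 2026-08-18 (`HOME/pub-hodgecm-prl2-g3/lean/Prl2g3/HomSupply.lean`, md5 9723ff8e, 357 lines);
landed by the gen-6 packager in gate run 22 as `HodgeCM/StubTree/HomSupply.lean` (verbatim).
-/
/-
Origin: HOME/pub-hodgecm-prl2-g3/lean/Prl2g3/HomSupply.lean — session planner-pub-hodgecm-prl2-g3-0 (unit pub-hodgecm-prl2-g3,
gen 3: expansion prover a-2, REDUCE, don't construct).  Intended final place: `HodgeCM/StubTree/HomSupply.lean`
(imports `HodgeCM.StubTree.SupplySplit`, the gen-2 file).  Nothing here is asserted: every published input is a named `Prop`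
consumed as an explicit hypothesis; every `theorem` is kernel-checked, no placeholders.
-/
import Mathlib.LinearAlgebra.TensorProduct.Pi
import Mathlib.RingTheory.Flat.Basic
import Summits.HodgeConjecture.HodgeCM.StubTree.SupplySplit
import Summits.HodgeConjecture.HodgeCM.Proofs.Prop22.Basic
import Summits.HodgeConjecture.HodgeCM.CM.Lemmas

set_option autoImplicit false

/-!
# Supply from morphisms: `U_Ψ(Γ)_σ ≠ 0 ⟺ some F : P_Γ → A_{(K,Ψ)} has F^* ≠ 0 on H¹` (KERNEL)

The gen-2 supply input of the whole assembly is (S₀₁ᵉ) `TypeSupplyEach01`: for the two types `Ψ₀, Ψ₁` of the (12)-pair,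
SOME level `Γ` has a nonzero isotypic space `U_{Ψ_i}(Γ)_σ` (the span of the pull-backs `F^*α` of holomorphic `σ`-eigen
one-forms `α` of `A_{(K,Ψ_i)}` along morphisms `F : P_Γ → A_{(K,Ψ_i)}`).  Print (Liu, Camb. J. Math. 9 (2021) =
arXiv:2102.11518, Thm 4.18 with Prop 4.13) delivers MORPHISMS: `Hom(A_K, A_μ)_ℚ ≠ 0` at a sufficiently small level.  The
passage "nonzero morphism ⇒ nonzero pulled-back one-form line" was recorded by gen 2 as a prose lemma (REDUCTION-v2 §1 (S5):
"not expressible over `Universe` primitives").  THIS FILE MAKES IT A KERNEL THEOREM over the primitives, for one morphism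
at a time and for imprimitive types as well:

* §1 `baseChange_apply_ne_zero_of_eigen` (pure linear algebra): if `K` acts `ℚ`-linearly on `V` with
  `dim_ℚ V ≤ [K:ℚ]`, `f : V → W` is a nonzero `ℚ`-linear map and `x ∈ V_ℂ` is a nonzero simultaneous eigenvector of `K`, then
  `f_ℂ x ≠ 0`.  (Proof: the vectors `v` whose whole `K`-orbit lies in `ker f` form a `K`-stable subspace; a nonzero one spans a
  copy of `K`, of dimension `[K:ℚ] ≥ dim V`, forcing `f = 0`; so `v ↦ (f(ι(b_i)v))_i` over a `ℚ`-basis `b` of `K` is injective,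
  hence injective after the flat base change `ℚ → ℂ` (Mathlib `Module.Flat.lTensor_preserves_injective_linearMap`,
  `TensorProduct.piRight`), and on the eigenvector its components are `σ(b_i) f_ℂ x`.)
* `pullC_ne_zero_of_mem_eigenLine`: for ANY morphism `F : X → A_{(K,Ψ)}` with `F^* ≠ 0` on `H¹(−,ℚ)` and any nonzero
  `σ`-eigenvector `α`, `F^*α ≠ 0` — from M22 `Fact_H1_rank` alone.
* `Uiso_ne_bot_iff_homNV` (M12, M13, M22): for `σ ∈ Ψ`, `U_Ψ(Γ)_σ ≠ ⊥ ↔ HomNV (P_Γ) K Ψ := ∃ F, F^*|_{H¹} ≠ 0`; and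
  `Uiso_eq_bot_of_not_mem`: for `σ ∉ Ψ` the space is `⊥` (so (S₀₁ᵉ) genuinely needs `σ ∈ Ψ₀ ∩ Ψ₁`, which the PerL sign table
  and face admissibility provide).
* §2 the σ-free supply statements `HomSupplyEach01 (PerL/Face)` with `typeSupplyEach01*_of_hom*` and the rewired headlines
  `perL44/periodThmF/perL/w_rk4/COR_CM_of_hom_pieces`; the generic domination transfer `homNV_of_dominated` (if finitely many
  `p_j : A_{(M,Θ)} → A_{(K,Ψ)}` have `Σ_j p_j^*` surjective on `H¹` — the `H¹`-shape of an isogeny `A_{(M,Θ)} ∼ A_{(K,Ψ)}^m`,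
  verbatim the first clause of M38 `Fact_cmInflation` of `PerL34/ThetaSubOfLiu` for the inflated type `Θ = Ψ^M` — then
  `HomNV X (M,Θ) → HomNV X (K,Ψ)`).

What this file does NOT contain: no print interface is typed here (that is `PerL34.ThetaSubOfLiu.Fact_thetaAlbanese`, seam S6,
and the dossier `HOME/pub-hodgecm-prl2-g3/REDUCTION-v3.md` §2); the dictionary (D) "Liu's `(A_μ, i_μ)` has CM type inflated from
`Ψ_i` along `σ`" remains THE OBSTRUCTION of the reduction and is not a theorem of this package.
-/

noncomputable section

open scoped TensorProduct

namespace HodgeCM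

/-! ## §1 KERNEL: a nonzero map out of a `K`-line does not kill a `K`-eigenvector -/

section KLine

variable {K : Type*} [Field K] [Algebra ℚ K]
variable {V : Type*} [AddCommGroup V] [Module ℚ V]
variable {W : Type*} [AddCommGroup W] [Module ℚ W]

/-- Evaluation of an action at a vector: `e ↦ ι(e) x`. -/
def evalAct (ι : K →ₐ[ℚ] Module.End ℚ V) (x : V) : K →ₗ[ℚ] V where
  toFun e := ι e x
  map_add' a b := by simp
  map_smul' c a := by simp

/-- (Ported verbatim from the HodgeCMPerL package; no docstring in the source.) -/
@[simp] theorem evalAct_apply (ι : K →ₐ[ℚ] Module.End ℚ V) (x : V) (e : K) : evalAct ι x e = ι e x := rfl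

/-- `K` is a field, so the orbit map of a nonzero vector is injective. -/
theorem evalAct_injective (ι : K →ₐ[ℚ] Module.End ℚ V) {x : V} (hx : x ≠ 0) :
    Function.Injective (evalAct ι x) := by
  rw [← LinearMap.ker_eq_bot, LinearMap.ker_eq_bot']
  intro e he
  by_contra he0
  apply hx
  have h : ι (e⁻¹ * e) x = 0 := by
    rw [map_mul, Module.End.mul_apply]
    change ι e⁻¹ (evalAct ι x e) = 0
    rw [he, map_zero]
  rwa [inv_mul_cancel₀ he0, map_one, Module.End.one_apply] at h

/-- **The `K`-line lemma.**  If `dim_ℚ V ≤ [K:ℚ]` and `f ≠ 0`, no nonzero vector has its whole `K`-orbit inside `ker f`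
(a nonzero orbit spans an injective image of `K`, of dimension `[K:ℚ] ≥ dim_ℚ V`, inside `ker f`). -/
theorem eq_zero_of_forall_act_mem_ker [FiniteDimensional ℚ K] [Module.Finite ℚ V] (ι : K →ₐ[ℚ] Module.End ℚ V)
    (hV : Module.finrank ℚ V ≤ Module.finrank ℚ K) {f : V →ₗ[ℚ] W} (hf : f ≠ 0) {x : V}
    (hx : ∀ e : K, f (ι e x) = 0) : x = 0 := by
  by_contra hx0
  apply hf
  have hle : LinearMap.range (evalAct ι x) ≤ LinearMap.ker f := by
    rintro _ ⟨e, rfl⟩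
    exact hx e
  have h1 : Module.finrank ℚ (LinearMap.range (evalAct ι x)) = Module.finrank ℚ K :=
    LinearMap.finrank_range_of_inj (evalAct_injective ι hx0)
  have h2 := Submodule.finrank_mono hle
  have h3 := Submodule.finrank_le (LinearMap.ker f)
  have hker : LinearMap.ker f = ⊤ := Submodule.eq_top_of_finrank_eq (by omega)
  exact LinearMap.ker_eq_top.mp hker

/-- Basis reduction: it suffices that the orbit under a `ℚ`-basis of `K` lies in `ker f`. -/
theorem forall_act_mem_ker_of_basis (ι : K →ₐ[ℚ] Module.End ℚ V) {I : Type*} (b : Module.Basis I ℚ K)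
    (f : V →ₗ[ℚ] W) {x : V} (hx : ∀ i, f (ι (b i) x) = 0) : ∀ e : K, f (ι e x) = 0 := by
  have h : f ∘ₗ evalAct ι x = 0 := b.ext fun i => by simpa using hx i
  intro e
  simpa using LinearMap.congr_fun h e

/-- Base change to `ℂ` of a finite family: if every `(g i)_ℂ` kills `x`, then `(LinearMap.pi g)_ℂ x = 0`
(`ℂ ⊗ (Π_i W) ≅ Π_i (ℂ ⊗ W)` for a finite family, Mathlib `TensorProduct.piRight`). -/
theorem baseChange_pi_apply_eq_zero {n : ℕ} (g : Fin n → (V →ₗ[ℚ] W)) {x : ℂ ⊗[ℚ] V}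
    (hx : ∀ i, (g i).baseChange ℂ x = 0) : (LinearMap.pi g).baseChange ℂ x = 0 := by
  apply (TensorProduct.piRight ℚ ℂ ℂ (fun _ : Fin n => W)).injective
  rw [map_zero]
  funext i
  rw [TensorProduct.piRight_apply, Pi.zero_apply]
  have key : ∀ z : ℂ ⊗[ℚ] V,
      TensorProduct.piRightHom ℚ ℂ ℂ (fun _ : Fin n => W) ((LinearMap.pi g).baseChange ℂ z) i =
        (g i).baseChange ℂ z := by
    intro z
    induction z using TensorProduct.induction_on with
    | zero => simp only [map_zero, Pi.zero_apply]
    | tmul c v =>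
      rw [LinearMap.baseChange_tmul, LinearMap.baseChange_tmul, TensorProduct.piRightHom_tmul]
      rfl
    | add a a' ha ha' => rw [map_add, map_add, Pi.add_apply, ha, ha', map_add]
  rw [key, hx i]

/-- **Kernel lemma (complexified form).**  `K` acts `ℚ`-linearly on `V` with `dim_ℚ V ≤ [K:ℚ]`; `f : V → W` is a nonzero
`ℚ`-linear map; `x ∈ ℂ ⊗_ℚ V` is a nonzero simultaneous eigenvector of `K` (`ι(e)_ℂ x = χ(e) x`).  Then `f_ℂ x ≠ 0`. -/
theorem baseChange_apply_ne_zero_of_eigen [FiniteDimensional ℚ K] [Module.Finite ℚ V]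
    (ι : K →ₐ[ℚ] Module.End ℚ V) (hV : Module.finrank ℚ V ≤ Module.finrank ℚ K) {f : V →ₗ[ℚ] W} (hf : f ≠ 0)
    {χ : K → ℂ} {x : ℂ ⊗[ℚ] V} (hx : ∀ e : K, (ι e).baseChange ℂ x = χ e • x) (hx0 : x ≠ 0) :
    f.baseChange ℂ x ≠ 0 := by
  intro hfx
  apply hx0
  let b := Module.finBasis ℚ K
  let g : Fin (Module.finrank ℚ K) → (V →ₗ[ℚ] W) := fun i => f ∘ₗ ι (b i)
  have hinj : Function.Injective (LinearMap.pi g) := by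
    rw [← LinearMap.ker_eq_bot, LinearMap.ker_pi, Submodule.eq_bot_iff]
    intro v hv
    rw [Submodule.mem_iInf] at hv
    exact eq_zero_of_forall_act_mem_ker ι hV hf
      (forall_act_mem_ker_of_basis ι b f fun i => LinearMap.mem_ker.mp (hv i))
  have hinjC : Function.Injective ((LinearMap.pi g).baseChange ℂ) := by
    rw [LinearMap.baseChange_eq_ltensor]
    exact Module.Flat.lTensor_preserves_injective_linearMap _ hinj
  have hgx : ∀ i, (g i).baseChange ℂ x = 0 := fun i => by
    simp only [g, LinearMap.baseChange_comp, LinearMap.comp_apply, hx, map_smul, hfx, smul_zero]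
  exact hinjC (by rw [baseChange_pi_apply_eq_zero g hgx, map_zero])

end KLine

/-! ## §1′ The kernel lemma in the geometric universe -/

namespace Universe

open Literature.AlgebraicGeometry.Motives (CMType)

variable {U : Universe}

/-- **For ANY morphism `F : X → A_{(K,Ψ)}` with `F^* ≠ 0` on `H¹(−,ℚ)` and any nonzero `σ`-eigenvector `α ∈ H¹(A_{(K,Ψ)}, ℂ)_σ`,
`F^*α ≠ 0`** — from M22 `Fact_H1_rank` (`dim_ℚ H¹(A_{(K,Ψ)},ℚ) = [K:ℚ]`) alone; valid for imprimitive types (no simplicity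
of `A_{(K,Ψ)}` is used).  `ker F^*` need not be `K`-stable; the point is that `α` is an eigenvector. -/
theorem pullC_ne_zero_of_mem_eigenLine (h22 : U.Fact_H1_rank) {K : CMField} {Ψ : CMType K} {X : U.Var}
    (F : U.Mor X (U.cmAV K Ψ)) (hF : U.pull F 1 ≠ 0) {σ : K →+* ℂ} {α : U.CohC (U.cmAV K Ψ) 1}
    (hα : α ∈ U.eigenLine K Ψ σ) (hα0 : α ≠ 0) : U.pullC F 1 α ≠ 0 :=
  baseChange_apply_ne_zero_of_eigen (U.cmAct K Ψ).ι (h22 K Ψ).le hF (mem_eigenLine_iff.mp hα) hα0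

/-- `Hom(X, A_{(K,Ψ)})` contains a morphism with NONZERO pull-back on `H¹(−,ℚ)` (for `X` smooth projective and `A` an abelian
variety: a non-constant morphism — equivalently `Hom(Alb X, A) ≠ 0`; the file only ever uses the `H¹` form). -/
def HomNV (U : Universe) (X : U.Var) (K : CMField) (Ψ : CMType K) : Prop :=
  ∃ F : U.Mor X (U.cmAV K Ψ), U.pull F 1 ≠ 0

section Iso

variable {L : CMField} {ι₁ : L →+* ℂ} {V : HermSpace3 L ι₁}

/-- For `σ ∈ Ψ` a nonzero holomorphic `σ`-eigen one-form exists (M12 + M13). -/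
theorem exists_mem_alphaLine_ne_zero (h12 : U.Fact_eigenLine) (h13 : U.Fact_alphaLine) (K : CMField) (Ψ : CMType K)
    {σ : K →+* ℂ} (hσ : σ ∈ Ψ.1) : ∃ α ∈ U.alphaLine K Ψ σ, α ≠ 0 := by
  apply Submodule.exists_mem_ne_zero_of_ne_bot
  intro hbot
  have h := h12 K Ψ σ
  rw [← (h13 K Ψ σ).1 hσ, hbot, finrank_bot] at h
  exact zero_ne_one h

/-- **Supply from one morphism (KERNEL, M12 M13 M22):** for `σ ∈ Ψ`, a morphism `F : P_Γ → A_{(K,Ψ)}` with `F^* ≠ 0` on `H¹`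
gives `U_Ψ(Γ)_σ ≠ ⊥` (it contains `F^*α_σ ≠ 0`). -/
theorem Uiso_ne_bot_of_pull_ne_zero (h12 : U.Fact_eigenLine) (h13 : U.Fact_alphaLine) (h22 : U.Fact_H1_rank)
    (Γ : Level V) {K : CMField} {Ψ : CMType K} {σ : K →+* ℂ} (hσ : σ ∈ Ψ.1)
    (F : U.Mor (U.pms L ι₁ V Γ) (U.cmAV K Ψ)) (hF : U.pull F 1 ≠ 0) : U.Uiso Γ K Ψ σ ≠ ⊥ := by
  obtain ⟨α, hα, hα0⟩ := exists_mem_alphaLine_ne_zero h12 h13 K Ψ hσ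
  rw [Submodule.ne_bot_iff]
  refine ⟨U.pullC F 1 α, Submodule.subset_span ⟨F, α, hα, rfl⟩, ?_⟩
  exact pullC_ne_zero_of_mem_eigenLine h22 F hF (alphaLine_le_eigenLine K Ψ σ hα) hα0

/-- Conversely (no facts needed): if every morphism `P_Γ → A_{(K,Ψ)}` is zero on `H¹`, the isotypic space is `⊥`. -/
theorem homNV_of_Uiso_ne_bot (Γ : Level V) {K : CMField} {Ψ : CMType K} {σ : K →+* ℂ}
    (h : U.Uiso Γ K Ψ σ ≠ ⊥) : U.HomNV (U.pms L ι₁ V Γ) K Ψ := by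
  by_contra hno
  apply h
  rw [Universe.Uiso, Submodule.span_eq_bot]
  rintro ω ⟨F, α, -, rfl⟩
  have hF : U.pull F 1 = 0 := by
    by_contra hF
    exact hno ⟨F, hF⟩
  simp [Universe.pullC, hF]

/-- **`U_Ψ(Γ)_σ ≠ ⊥ ⟺ HomNV`** for `σ ∈ Ψ` (M12, M13, M22). -/
theorem Uiso_ne_bot_iff_homNV (h12 : U.Fact_eigenLine) (h13 : U.Fact_alphaLine) (h22 : U.Fact_H1_rank)
    (Γ : Level V) {K : CMField} {Ψ : CMType K} {σ : K →+* ℂ} (hσ : σ ∈ Ψ.1) :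
    U.Uiso Γ K Ψ σ ≠ ⊥ ↔ U.HomNV (U.pms L ι₁ V Γ) K Ψ :=
  ⟨homNV_of_Uiso_ne_bot Γ, fun ⟨F, hF⟩ => Uiso_ne_bot_of_pull_ne_zero h12 h13 h22 Γ hσ F hF⟩

/-- For `σ ∉ Ψ` the isotypic space is `⊥` whatever the morphisms (M13: no holomorphic `σ`-eigen one-forms) — so the supply
statements are NOT satisfiable off the type, and (S₀₁ᵉ) at `σ` needs `σ ∈ Ψ₀ ∩ Ψ₁`. -/
theorem Uiso_eq_bot_of_not_mem (h13 : U.Fact_alphaLine) (Γ : Level V) {K : CMField} {Ψ : CMType K} {σ : K →+* ℂ}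
    (hσ : σ ∉ Ψ.1) : U.Uiso Γ K Ψ σ = ⊥ := by
  rw [Universe.Uiso, Submodule.span_eq_bot]
  rintro ω ⟨F, α, hα, rfl⟩
  rw [(h13 K Ψ σ).2 hσ, Submodule.mem_bot] at hα
  simp [hα]

end Iso

/-! ## §2 Transfer along a dominating family, and the σ-free supply statements -/

/-- **Domination transfer (KERNEL, M2).**  If finitely many morphisms `p_j : B → A_{(K,Ψ)}` have `(β_j) ↦ Σ_j p_j^*β_j`
SURJECTIVE onto `H¹(B,ℚ)` — the `H¹`-form of "`B` is isogenous to a power of `A_{(K,Ψ)}`", verbatim the first clause of M38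
`Fact_cmInflation` (Shimura, *Abelian Varieties with CM* (1998) §6.2 Thm 3) for `B = A_{(M,Ψ^M)}` — then a morphism
`F : X → B` with `F^* ≠ 0` on `H¹` yields some `F;p_j : X → A_{(K,Ψ)}` with nonzero pull-back. -/
theorem exists_pull_comp_ne_zero (hc : U.Fact_pull_comp) {X B : U.Var} {K : CMField} {Ψ : CMType K} {m : ℕ}
    (p : Fin m → U.Mor B (U.cmAV K Ψ))
    (hp : Function.Surjective
      (∑ j : Fin m, U.pull (p j) 1 ∘ₗ LinearMap.proj j : (Fin m → U.Coh (U.cmAV K Ψ) 1) →ₗ[ℚ] U.Coh B 1))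
    (F : U.Mor X B) (hF : U.pull F 1 ≠ 0) : ∃ j, U.pull (U.comp F (p j)) 1 ≠ 0 := by
  by_contra hall
  push Not at hall
  apply hF
  apply LinearMap.ext
  intro y
  obtain ⟨β, rfl⟩ := hp y
  rw [LinearMap.zero_apply, LinearMap.sum_apply, map_sum]
  refine Finset.sum_eq_zero fun j _ => ?_
  have h := LinearMap.congr_fun (hall j) (β j)
  rw [hc, LinearMap.comp_apply, LinearMap.zero_apply] at h
  simpa using h

/-- Hence `HomNV X B-with-its-type-data → HomNV X (K,Ψ)` along such a family; stated for `B = A_{(M,Θ)}`. -/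
theorem homNV_of_dominated (hc : U.Fact_pull_comp) {X : U.Var} {K M : CMField} {Ψ : CMType K} {Θ : CMType M} {m : ℕ}
    (p : Fin m → U.Mor (U.cmAV M Θ) (U.cmAV K Ψ))
    (hp : Function.Surjective
      (∑ j : Fin m, U.pull (p j) 1 ∘ₗ LinearMap.proj j : (Fin m → U.Coh (U.cmAV K Ψ) 1) →ₗ[ℚ] U.Coh (U.cmAV M Θ) 1))
    (h : U.HomNV X M Θ) : U.HomNV X K Ψ := by
  obtain ⟨F, hF⟩ := h
  obtain ⟨j, hj⟩ := exists_pull_comp_ne_zero hc p hp F hF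
  exact ⟨U.comp F (p j), hj⟩

variable (U)

/-- **(H₀₁ᵉ) Hom-supply of the (12)-pair, each type at its own level, σ-FREE**: for `i = 0, 1` some level `Γ` carries a
morphism `P_Γ → A_{(K,Ψ_i)}` with nonzero pull-back on `H¹`.  This is the shape print delivers (Liu 2021 Thm 4.18 (1) with
Prop 4.13: `Hom_E(A_K, A_μ)_ℚ ≅ Ω(μ)^K ≠ 0` for `K` sufficiently small, read through the dictionary (D) — dossier
REDUCTION-v3.md §2).  WHY IT MIGHT FAIL: only through (D) (which CM type Liu's `A_μ ⊗_{ι₁} ℂ` carries). -/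
def HomSupplyEach01 {L : CMField} {ι₁ : L →+* ℂ} (V : HermSpace3 L ι₁) (K : CMField) (Ψ : Fin 4 → CMType K) : Prop :=
  (∃ Γ : Level V, U.HomNV (U.pms L ι₁ V Γ) K (Ψ 0)) ∧ (∃ Γ : Level V, U.HomNV (U.pms L ι₁ V Γ) K (Ψ 1))

/-- (H₀₁ᵉ) under the PerL binders (PerL v5 Thm 4.4): types `t¹, t²`. -/
def HomSupplyEach01PerL : Prop :=
  ∀ (K L : CMField) (j : K →+* L), IsNormalClosure ℚ K L →
    Module.finrank ℚ K = 6 → (Module.finrank ℚ L = 24 ∨ Module.finrank ℚ L = 48) →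
    ∀ (φ : Fin 3 → (K →+* ℂ)), IsFrame φ →
    ∀ (ι₁ : L →+* ℂ), ι₁.comp j = φ 0 →
    ∀ (t : Fin 4 → CMType K), IsPerLTypes φ t →
    ∀ V : HermSpace3 L ι₁, U.HomSupplyEach01 V K t

/-- (H₀₁ᵉ) under the face binders (rfwf v3 Thm 4.1): period types `Ψ₁ = Φ`, `Ψ₂ = Φ^{(ππ′)}` of the face. -/
def HomSupplyEach01Face : Prop :=
  ∀ (F : CMField), IsGalois ℚ F → 6 ≤ Module.finrank ℚ F →
    ∀ (f : Face F) (ι₁ : F →+* ℂ), f.Admissible ι₁ →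
    ∀ V : HermSpace3 F ι₁, U.HomSupplyEach01 V F f.psi

variable {U}

/-- (H₀₁ᵉ) ⇒ (S₀₁ᵉ) at every `σ ∈ Ψ₀ ∩ Ψ₁` (KERNEL, M12 M13 M22). -/
theorem typeSupplyEach01_of_homSupply (h12 : U.Fact_eigenLine) (h13 : U.Fact_alphaLine) (h22 : U.Fact_H1_rank)
    {L : CMField} {ι₁ : L →+* ℂ} {V : HermSpace3 L ι₁} {K : CMField} {Ψ : Fin 4 → CMType K} {σ : K →+* ℂ}
    (hσ0 : σ ∈ (Ψ 0).1) (hσ1 : σ ∈ (Ψ 1).1) (h : U.HomSupplyEach01 V K Ψ) : U.TypeSupplyEach01 V K Ψ σ := by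
  obtain ⟨⟨Γ₀, F₀, hF₀⟩, ⟨Γ₁, F₁, hF₁⟩⟩ := h
  exact ⟨⟨Γ₀, Uiso_ne_bot_of_pull_ne_zero h12 h13 h22 Γ₀ hσ0 F₀ hF₀⟩,
    ⟨Γ₁, Uiso_ne_bot_of_pull_ne_zero h12 h13 h22 Γ₁ hσ1 F₁ hF₁⟩⟩

/-- Conversely (S₀₁ᵉ) at any `σ` ⇒ (H₀₁ᵉ) (no facts): the two supply inputs are EQUIVALENT given `σ ∈ Ψ₀ ∩ Ψ₁`. -/
theorem homSupply_of_typeSupplyEach01 {L : CMField} {ι₁ : L →+* ℂ} {V : HermSpace3 L ι₁} {K : CMField}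
    {Ψ : Fin 4 → CMType K} {σ : K →+* ℂ} (h : U.TypeSupplyEach01 V K Ψ σ) : U.HomSupplyEach01 V K Ψ := by
  obtain ⟨⟨Γ₀, h₀⟩, ⟨Γ₁, h₁⟩⟩ := h
  exact ⟨⟨Γ₀, homNV_of_Uiso_ne_bot Γ₀ h₀⟩, ⟨Γ₁, homNV_of_Uiso_ne_bot Γ₁ h₁⟩⟩

/-- PerL's frame embedding `φ₁` lies in `t¹` and `t²` (sign table: `+` in the first place for every `tⁱ`). -/
theorem frame_mem_of_isPerLTypes {K : Type} [Field K] {φ : Fin 3 → (K →+* ℂ)} {t : Fin 4 → CMType K}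
    (ht : IsPerLTypes φ t) (i : Fin 4) : φ 0 ∈ (t i).1 := by
  rw [ht i 0]
  fin_cases i <;> rfl

/-- (Ported verbatim from the HodgeCMPerL package; no docstring in the source.) -/
theorem typeSupplyEach01PerL_of_hom (h12 : U.Fact_eigenLine) (h13 : U.Fact_alphaLine) (h22 : U.Fact_H1_rank)
    (h : U.HomSupplyEach01PerL) : U.TypeSupplyEach01PerL := by
  intro K L j hN hK hL φ hφ ι₁ hι t ht V
  exact typeSupplyEach01_of_homSupply h12 h13 h22 (frame_mem_of_isPerLTypes ht 0) (frame_mem_of_isPerLTypes ht 1)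
    (h K L j hN hK hL φ hφ ι₁ hι t ht V)

/-- (Ported verbatim from the HodgeCMPerL package; no docstring in the source.) -/
theorem typeSupplyEach01Face_of_hom (h12 : U.Fact_eigenLine) (h13 : U.Fact_alphaLine) (h22 : U.Fact_H1_rank)
    (h : U.HomSupplyEach01Face) : U.TypeSupplyEach01Face := by
  intro F hG h6 f ι₁ hadm V
  exact typeSupplyEach01_of_homSupply h12 h13 h22 (admissible_mem_psi f ι₁ hadm 0) (admissible_mem_psi f ι₁ hadm 1)
    (h F hG h6 f ι₁ hadm V)

/-- (Ported verbatim from the HodgeCMPerL package; no docstring in the source.) -/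
theorem homSupplyEach01PerL_of_type (h : U.TypeSupplyEach01PerL) : U.HomSupplyEach01PerL :=
  fun K L j hN hK hL φ hφ ι₁ hι t ht V => homSupply_of_typeSupplyEach01 (h K L j hN hK hL φ hφ ι₁ hι t ht V)

/-- (Ported verbatim from the HodgeCMPerL package; no docstring in the source.) -/
theorem homSupplyEach01Face_of_type (h : U.TypeSupplyEach01Face) : U.HomSupplyEach01Face :=
  fun F hG h6 f ι₁ hadm V => homSupply_of_typeSupplyEach01 (h F hG h6 f ι₁ hadm V)

variable (U)

/-! ### Headlines rewired to the Hom-supply input -/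

/-- **PerL Thm 4.4** from the model facts, Venkataramana's Theorem 8 (two-level reading, V₂), Hom-supply of the (12)-pair
(H₀₁ᵉ) and the pairing piece (P). -/
theorem perL44_of_hom_pieces (M : U.ModelAxioms) (hV : U.Fact_virtualCup11₂) (hS : U.HomSupplyEach01PerL)
    (hP : U.PairingPerL) : U.PerL44 :=
  perL44_of_pieces₂ U M hV (typeSupplyEach01PerL_of_hom M.eigenLine M.alphaLine M.H1_rank hS) hP

/-- **rfwf Thm 4.1** from the model facts, (V₂), (H₀₁ᵉ) for faces and (P). -/
theorem periodThmF_of_hom_pieces (M : U.ModelAxioms) (hV : U.Fact_virtualCup11₂) (hS : U.HomSupplyEach01Face)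
    (hP : U.PairingFace) : U.PeriodThmF :=
  periodThmF_of_pieces₂ U M hV (typeSupplyEach01Face_of_hom M.eigenLine M.alphaLine M.H1_rank hS) hP

/-- **PerL** (`W_per^L`) from the Hom pieces. -/
theorem perL_of_hom_pieces (M : U.ModelAxioms) (hV : U.Fact_virtualCup11₂) (hS : U.HomSupplyEach01PerL)
    (hP : U.PairingPerL) : U.PerL :=
  perL_of_pieces₂ U M hV (typeSupplyEach01PerL_of_hom M.eigenLine M.alphaLine M.H1_rank hS) hP

/-- **`W^{RK4}`** from the Hom face pieces. -/
theorem w_rk4_of_hom_pieces (M : U.ModelAxioms) (hV : U.Fact_virtualCup11₂) (hS : U.HomSupplyEach01Face)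
    (hP : U.PairingFace) : U.W_RK4 :=
  w_rk4_of_pieces₂ U M hV (typeSupplyEach01Face_of_hom M.eigenLine M.alphaLine M.H1_rank hS) hP

/-- **COR-CM** from the 28 model facts, Venkataramana's Theorem 8 (two-level reading), Hom-supply of the (12)-pair of every
admissible face, the pairing piece (P) and the two face-reduction inputs (Pohlmann; [QW8]+Milne). -/
theorem COR_CM_of_hom_pieces (M : U.ModelAxioms) (hV : U.Fact_virtualCup11₂) (hS : U.HomSupplyEach01Face)
    (hP : U.PairingFace) (hPo : U.PohlmannSpan) (hQ : U.Qw8Sufficiency) : U.HC_CM :=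
  COR_CM_of_pieces₂ U M hV (typeSupplyEach01Face_of_hom M.eigenLine M.alphaLine M.H1_rank hS) hP hPo hQ

end Universe

end HodgeCM

end
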